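import Mathlib
import Literature.AlgebraicGeometry.Resolution.CobordantGame
import Summits.ResolutionOfSingularities.ResolutionOfSingularities.Theorems.WeightedInvariantLocalWeightedDropOrbitQuasiInvariance
import Summits.ResolutionOfSingularities.ResolutionOfSingularities.Theorems.WeightedInvariantLocalWeightedDropSigmaEmbedding

/-!
# `WeightedInvariant.LocalWeightedDrop`: WILD SUCCESSORS AT AN AXIS POINT ARE TWISTED CYLINDERS (§1 B2)

Route `ResolutionOfSingularities/WeightedInvariant`, crux `LocalWeightedDrop`
(stmt-ResolutionOfSingularities-8899).  [OURS · L1 W4.3] — §1 B2 of ideator res-L1-w43-idea-1's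
`Sketch-L1-idea-1.lean` v3 (sha16 `631198685223c190`): at an AXIS exceptional point `c = c₀ e_{i₀}` of a
weighted cobordant chart the `s`-saturated successor `g` is TWISTED-TRIVIAL along the `y_{i₀}`-axis with
exponent `p^e`, `e = v_p(w_{i₀})`.  Nothing here is a statement of the manuscript under review on ladder
RESOLUTION; AI-produced, weaker than expert review.

TYPING NOTE (kernel probe `HOME/L/res-type-099-w43/TwistedTrivialVacuity.lean`, evidence #52 on the crux
item): the sketch's predicate `TwistedTrivialAlong` AS TYPED only asks the `σ`-dependent coordinate family
`Φ` to have zero constant terms and invertible linear part in the shifted variables, and is therefore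
satisfied by the translation itself (it is equivalent to `γ(0) = 0`).  This file lands the sketch's
predicate VERBATIM together with the repaired predicate `TwistedTrivialAlongFix` (OURS: additionally
`Φⱼ(σ, 0) = 0` — the automorphism FIXES THE ORIGIN of the `x`-space for every `σ`), and proves B2 for the
repaired predicate (`successor_twistedTrivialFix_axis`), hence for the typed one
(`successor_twistedTrivial_axis`, signature verbatim).

PROOF.  Write `w_{i₀} = p^e·m`, `p ∤ m`, pick `d ∈ k` with `d^{p^e} = c₀⁻¹` (`k` algebraically closed) and
`λ₁ ∈ k⟦σ⟧` with `λ₁^m = 1 + dσ`, `λ₁(0) = 1` (Hensel in the `σ`-adically complete ring `k⟦σ⟧`: `m` is a unit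
of `k`).  In characteristic `p`, `c₀ λ^{w_{i₀}} = c₀ (1 + dσ)^{p^e} = c₀ + σ^{p^e}`.  Hence the two families
`σL = (s ↦ s, yᵢ ↦ λ^{wᵢ} yᵢ + [i = i₀] σ^{p^e})` and `σR = (s ↦ λ s, y ↦ y)` AGREE on the chart at the axis
point, and the generic cancellation lemma `GradedGame.subst_eq_mul_subst_of_chart_factor` (landed with the
orbit lemma) gives `g(σL) = λᵃ · g(σR)`.  Undoing the diagonal scaling `yᵢ ↦ λ^{wᵢ} yᵢ` (λ is a unit) turns
this into `g(s, y + σ^{p^e} e_{i₀}) = λᵃ · g(λ s, λ^{-w} y)`: the translation along the axis is undone by the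
origin-fixing diagonal automorphism `Φ = (s ↦ λ s, yᵢ ↦ λ^{-wᵢ} yᵢ)` and the unit `λᵃ`.
-/

set_option linter.dupNamespace false -- mandated namespace of this single-conjunct summit
set_option autoImplicit false

namespace Summit.ResolutionOfSingularities.ResolutionOfSingularities.Theorems

namespace GradedGame

open MvPowerSeries
open Literature.AlgebraicGeometry.Resolution

variable {k : Type} [Field k]

/-! ## The predicates (sketch verbatim + OURS repair) -/

/-- TWISTED TRIVIALITY of exponent `p^e` along the formal curve `γ` (through the origin): translating `f` by
`γ(σ^{p^e})` (`σ = X 0` of `Fin (n+1)`) is undone OVER `k[[σ]]` by a `σ`-dependent formal automorphism `Φ` of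
the `x`-variables and a unit `u`.  [OURS · L1 W4.3, Sketch-L1-idea-1 v3 §1 — VERBATIM; see the module
docstring: as typed this is equivalent to `∀ i, constantCoeff (γ i) = 0`.] -/
def TwistedTrivialAlong (p : ℕ) {n : ℕ} (f : MvPowerSeries (Fin n) k) (γ : Fin n → MvPowerSeries (Fin 1) k) :
    Prop :=
  (∀ i, constantCoeff (γ i) = 0) ∧
  ∃ (e : ℕ) (Φ : Fin n → MvPowerSeries (Fin (n + 1)) k) (u : MvPowerSeries (Fin (n + 1)) k),
    IsUnit u ∧ (∀ j, constantCoeff (Φ j) = 0) ∧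
    IsUnit (Matrix.det (Matrix.of fun i j : Fin n => coeff (Finsupp.single j.succ 1) (Φ i))) ∧
    subst (fun i : Fin n => X i.succ + subst (fun _ : Fin 1 => X (0 : Fin (n + 1)) ^ (p ^ e)) (γ i)) f
      = u * subst Φ f

/-- OURS repair of `TwistedTrivialAlong`: the `σ`-dependent automorphism `Φ` moreover FIXES THE ORIGIN of the
`x`-space for every `σ` — `Φⱼ(σ, 0, …, 0) = 0`, i.e. `Φⱼ` has no pure-`σ` terms (third conjunct under the
existential).  This excludes the translation `xᵢ ↦ xᵢ + γᵢ(σ^{p^e})`. [OURS · L1 W4.3] -/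
def TwistedTrivialAlongFix (p : ℕ) {n : ℕ} (f : MvPowerSeries (Fin n) k) (γ : Fin n → MvPowerSeries (Fin 1) k) :
    Prop :=
  (∀ i, constantCoeff (γ i) = 0) ∧
  ∃ (e : ℕ) (Φ : Fin n → MvPowerSeries (Fin (n + 1)) k) (u : MvPowerSeries (Fin (n + 1)) k),
    IsUnit u ∧ (∀ j, constantCoeff (Φ j) = 0) ∧
    (∀ j, subst (fun v : Fin (n + 1) => if v = 0 then (X (0 : Fin (n + 1)) : MvPowerSeries (Fin (n + 1)) k)
      else 0) (Φ j) = 0) ∧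
    IsUnit (Matrix.det (Matrix.of fun i j : Fin n => coeff (Finsupp.single j.succ 1) (Φ i))) ∧
    subst (fun i : Fin n => X i.succ + subst (fun _ : Fin 1 => X (0 : Fin (n + 1)) ^ (p ^ e)) (γ i)) f
      = u * subst Φ f

/-- The repaired predicate refines the sketch's. [OURS · L1 W4.3] -/
theorem twistedTrivialAlong_of_fix (p : ℕ) {n : ℕ} (f : MvPowerSeries (Fin n) k)
    (γ : Fin n → MvPowerSeries (Fin 1) k) (h : TwistedTrivialAlongFix p f γ) : TwistedTrivialAlong p f γ := by
  obtain ⟨hγ, e, Φ, u, hu, hΦ, -, hdet, heq⟩ := h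
  exact ⟨hγ, e, Φ, u, hu, hΦ, hdet, heq⟩

/-- The `i`-th coordinate axis as a formal curve direction. [OURS · L1 W4.3, Sketch-L1-idea-1 v3 §1 — VERBATIM] -/
noncomputable def axisCurve {n : ℕ} (i : Fin n) : Fin n → MvPowerSeries (Fin 1) k :=
  fun j => if j = i then X (0 : Fin 1) else 0

/-! ## B2 under the repaired predicate -/

/-- B2 (REPAIRED PREDICATE) — WILD SUCCESSORS AT AN AXIS POINT ARE TWISTED CYLINDERS.  At an axis exceptional
point `c = c₀ e_{i₀}` (`c₀ ≠ 0 < w_{i₀}`) of the chart `chart_c`, the `s`-saturated successor `g` of `F`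
(`F(chart_c) = sᵃ·g`) is twisted-trivial along the `y_{i₀}`-axis in the ORIGIN-FIXING sense
`TwistedTrivialAlongFix`, with exponent `e = v_p(w_{i₀})`: `g(s, y + σ^{p^e} e_{i₀}) = λᵃ · g(λ s, λ^{-w} y)` for an
`m`-th root `λ` of `1 + c₀^{-1/p^e} σ`, `w_{i₀} = p^e m`.  (The hypothesis `s ∤ g` of the sketch is not needed.)
[OURS · L1 W4.3] -/
theorem successor_twistedTrivialFix_axis (p : ℕ) [Fact p.Prime] [CharP k p] [IsAlgClosed k] {n : ℕ}
    (F : MvPowerSeries (Fin n) k) (w : Fin n → ℕ) (c : Fin n → k) (i₀ : Fin n)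
    (hc : ∀ i, i ≠ i₀ → c i = 0) (hc₀ : c i₀ ≠ 0) (hw : 0 < w i₀) (a : ℕ) (g : MvPowerSeries (Fin (n + 1)) k)
    (h : subst (CobordantGame.cruxChart k w c) F = X (0 : Fin (n + 1)) ^ a * g) :
    TwistedTrivialAlongFix p g (axisCurve i₀.succ) := by
  classical
  have hp : p.Prime := Fact.out
  -- the ambient ring `R = k⟦σ, s, y₁..yₙ⟧`: `σ = X 0`, `s = X (succ 0)`, `yᵢ = X i.succ.succ`
  -- Step 1: `w_{i₀} = p^e · m`, `p ∤ m`, `d^{p^e} = c₀⁻¹`, `λ₁^m = 1 + dσ`.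
  set e : ℕ := (w i₀).factorization p with he
  set m : ℕ := w i₀ / p ^ e with hm_def
  have hwm : p ^ e * m = w i₀ := Nat.ordProj_mul_ordCompl_eq_self (w i₀) p
  have hpm : ¬ p ∣ m := Nat.not_dvd_ordCompl hp (Nat.pos_iff_ne_zero.mp hw)
  have hmk : (m : k) ≠ 0 := fun h0 => hpm ((CharP.cast_eq_zero_iff k p m).mp h0)
  have hpe : 0 < p ^ e := Nat.pos_of_ne_zero (pow_ne_zero e hp.ne_zero)
  obtain ⟨d, hd⟩ := IsAlgClosed.exists_pow_nat_eq (c i₀)⁻¹ hpe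
  obtain ⟨lam1, hlam1, hlam1c⟩ := exists_pow_eq_one_add_C_mul_X (k := k) m hmk d
  -- Step 2: embed along `σ = X 0`; `λ · λ⁻¹ = 1`; the key identity `C c₀ · λ^{w i₀} = C c₀ + σ^{p^e}`.
  haveI : CharP (MvPowerSeries (Fin (n + 2)) k) p := charP_of_injective_ringHom (C_injective) p
  set lam : MvPowerSeries (Fin (n + 2)) k := embσ lam1 with hlam
  set lamInv : MvPowerSeries (Fin (n + 2)) k := embσ lam1⁻¹ with hlamInv
  have hmulinv : lam * lamInv = 1 := by
    rw [hlam, hlamInv, ← embσ_mul, PowerSeries.mul_inv_cancel lam1 (by rw [hlam1c]; exact one_ne_zero), embσ_one]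
  have hlam_unit : IsUnit lam := isUnit_iff_exists_inv.mpr ⟨lamInv, hmulinv⟩
  have hpowinv : ∀ r : ℕ, lam ^ r * lamInv ^ r = 1 := fun r => by rw [← mul_pow, hmulinv, one_pow]
  have hkey : C (c i₀) * lam ^ (w i₀) = C (c i₀) + X (0 : Fin (n + 2)) ^ (p ^ e) := by
    have h1 : lam ^ m = 1 + C d * X 0 := by
      rw [hlam, ← embσ_pow, hlam1, embσ_add, embσ_one, embσ_mul, embσ_C, embσ_X]
    rw [← hwm, mul_comm (p ^ e) m, pow_mul, h1, add_pow_char_pow, one_pow, mul_pow, ← map_pow, hd, mul_add,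
      mul_one, ← mul_assoc, ← map_mul, mul_inv_cancel₀ hc₀, map_one, one_mul]
  -- Step 3: the two families agreeing on the chart, and the generic cancellation lemma.
  set σL : Fin (n + 1) → MvPowerSeries (Fin (n + 2)) k :=
    Fin.cases (X (Fin.succ 0)) (fun i => lam ^ (w i) * X i.succ.succ + if i = i₀ then X 0 ^ (p ^ e) else 0)
    with hσL
  set σR : Fin (n + 1) → MvPowerSeries (Fin (n + 2)) k := Fin.cases (lam * X (Fin.succ 0)) (fun i => X i.succ.succ)
    with hσR
  have hpe0 : p ^ e ≠ 0 := pow_ne_zero e hp.ne_zero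
  have hL : HasSubst σL := hasSubst_of_constantCoeff_zero fun v => by
    refine Fin.cases ?_ (fun i => ?_) v
    · simp [hσL, constantCoeff_X]
    · by_cases hi : i = i₀
      · simp [hσL, hi, constantCoeff_X, zero_pow hpe0]
      · simp [hσL, hi, constantCoeff_X]
  have hR : HasSubst σR := hasSubst_of_constantCoeff_zero fun v => by
    refine Fin.cases ?_ (fun i => ?_) v
    · simp [hσR, constantCoeff_X]
    · simp [hσR, constantCoeff_X]
  have hagree : ∀ i, subst σL (CobordantGame.cruxChart k w c i) = subst σR (CobordantGame.cruxChart k w c i) := by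
    intro i
    unfold CobordantGame.cruxChart
    by_cases hwi : 0 < w i
    · rw [if_pos hwi, subst_mul hL, subst_mul hR, subst_pow hL, subst_pow hR, subst_add hL, subst_add hR,
        subst_C, subst_C, subst_X hL, subst_X hR, subst_X hL, subst_X hR]
      by_cases hi : i = i₀
      · subst hi
        simp only [hσL, hσR, Fin.cases_zero, Fin.cases_succ, if_true]
        rw [mul_pow]
        linear_combination (-(X (Fin.succ (0 : Fin (n + 1))) : MvPowerSeries (Fin (n + 2)) k) ^ (w i)) * hkey
      · simp only [hσL, hσR, Fin.cases_zero, Fin.cases_succ, hi, if_false, hc i hi, map_zero, zero_add, add_zero]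
        rw [mul_pow]
        ring
    · have hw0 : w i = 0 := by omega
      have hi : i ≠ i₀ := by rintro rfl; omega
      rw [if_neg hwi, subst_X hL, subst_X hR]
      simp [hσL, hσR, hw0, hi]
  have E1 : subst σL g = lam ^ a * subst σR g :=
    subst_eq_mul_subst_of_chart_factor w c hL hR lam (by simp [hσL, hσR])
      (by simp only [hσL, Fin.cases_zero]; exact nonZeroDivisors.ne_zero X_mem_nonzeroDivisors) hagree F a g h
  -- Step 4: the diagonal scaling `D`, its inverse, the translation `T` and the automorphism `Φ`.
  set D : Fin (n + 2) → MvPowerSeries (Fin (n + 2)) k :=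
    Fin.cases (X 0) (Fin.cases (X (Fin.succ 0)) (fun i => lam ^ (w i) * X i.succ.succ)) with hD
  set Dinv : Fin (n + 2) → MvPowerSeries (Fin (n + 2)) k :=
    Fin.cases (X 0) (Fin.cases (X (Fin.succ 0)) (fun i => lamInv ^ (w i) * X i.succ.succ)) with hDinv
  set T : Fin (n + 1) → MvPowerSeries (Fin (n + 2)) k :=
    Fin.cases (X (Fin.succ 0)) (fun i => X i.succ.succ + if i = i₀ then X 0 ^ (p ^ e) else 0) with hT
  set Φ : Fin (n + 1) → MvPowerSeries (Fin (n + 2)) k :=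
    Fin.cases (lam * X (Fin.succ 0)) (fun i => lamInv ^ (w i) * X i.succ.succ) with hΦ
  have hDs : HasSubst D := hasSubst_of_constantCoeff_zero fun v => by
    refine Fin.cases ?_ (fun v' => Fin.cases ?_ (fun i => ?_) v') v
    · simp only [hD, Fin.cases_zero]; simp [constantCoeff_X]
    · simp only [hD, Fin.cases_zero, Fin.cases_succ]; simp [constantCoeff_X]
    · simp only [hD, Fin.cases_succ]; simp [constantCoeff_X]
  have hDinvs : HasSubst Dinv := hasSubst_of_constantCoeff_zero fun v => by
    refine Fin.cases ?_ (fun v' => Fin.cases ?_ (fun i => ?_) v') v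
    · simp only [hDinv, Fin.cases_zero]; simp [constantCoeff_X]
    · simp only [hDinv, Fin.cases_zero, Fin.cases_succ]; simp [constantCoeff_X]
    · simp only [hDinv, Fin.cases_succ]; simp [constantCoeff_X]
  have hTs : HasSubst T := hasSubst_of_constantCoeff_zero fun v => by
    refine Fin.cases ?_ (fun i => ?_) v
    · simp [hT, constantCoeff_X]
    · by_cases hi : i = i₀
      · simp [hT, hi, constantCoeff_X, zero_pow hpe0]
      · simp [hT, hi, constantCoeff_X]
  -- `D` fixes `λ`, `Dinv` fixes `λ` and `λ⁻¹`
  have hDinv_lam : subst Dinv lam = lam := by rw [hlam, subst_embσ hDinvs]; rfl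
  have hD_T : ∀ v, subst D (T v) = σL v := by
    intro v
    refine Fin.cases ?_ (fun i => ?_) v
    · simp only [hT, hσL, Fin.cases_zero]
      rw [subst_X hDs]
      simp only [hD, Fin.cases_zero, Fin.cases_succ]
    · simp only [hT, hσL, Fin.cases_succ]
      rw [subst_add hDs, subst_X hDs]
      by_cases hi : i = i₀
      · rw [if_pos hi, subst_pow hDs, subst_X hDs]
        simp only [hD, Fin.cases_zero, Fin.cases_succ]
      · rw [if_neg hi, ← coe_substAlgHom hDs, map_zero]
        simp only [hD, Fin.cases_succ]
  have E2 : subst σL g = subst D (subst T g) := by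
    rw [subst_comp_subst_apply hTs hDs]
    congr 1
    funext v
    exact (hD_T v).symm
  have hDinv_D : ∀ r, subst Dinv (D r) = X r := by
    intro r
    refine Fin.cases ?_ (fun r' => Fin.cases ?_ (fun i => ?_) r') r
    · simp only [hD, Fin.cases_zero]
      rw [subst_X hDinvs]
      simp only [hDinv, Fin.cases_zero]
    · simp only [hD, Fin.cases_zero, Fin.cases_succ]
      rw [subst_X hDinvs]
      simp only [hDinv, Fin.cases_zero, Fin.cases_succ]
    · simp only [hD, Fin.cases_succ]
      rw [subst_mul hDinvs, subst_pow hDinvs, hDinv_lam, subst_X hDinvs]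
      simp only [hDinv, Fin.cases_succ]
      rw [← mul_assoc, hpowinv, one_mul]
  have E3 : ∀ ψ : MvPowerSeries (Fin (n + 2)) k, subst Dinv (subst D ψ) = ψ := by
    intro ψ
    rw [subst_comp_subst_apply hDs hDinvs]
    have : (fun r => subst Dinv (D r)) = X := funext hDinv_D
    rw [this]
    exact congr_fun subst_self ψ
  have hDinv_R : ∀ v, subst Dinv (σR v) = Φ v := by
    intro v
    refine Fin.cases ?_ (fun i => ?_) v
    · simp only [hσR, hΦ, Fin.cases_zero]
      rw [subst_mul hDinvs, hDinv_lam, subst_X hDinvs]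
      simp only [hDinv, Fin.cases_zero, Fin.cases_succ]
    · simp only [hσR, hΦ, Fin.cases_succ]
      rw [subst_X hDinvs]
      simp only [hDinv, Fin.cases_succ]
  have E4 : subst Dinv (subst σR g) = subst Φ g := by
    rw [subst_comp_subst_apply hR hDinvs]
    congr 1
    funext v
    exact hDinv_R v
  have Emain : subst T g = lam ^ a * subst Φ g := by
    rw [← E3 (subst T g), ← E2, E1, subst_mul hDinvs, subst_pow hDinvs, hDinv_lam, E4]
  -- Step 5: the clauses of the repaired predicate.
  refine ⟨fun j => ?_, e, Φ, lam ^ a, hlam_unit.pow a, fun j => ?_, fun j => ?_, ?_, ?_⟩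
  · unfold axisCurve
    split_ifs <;> simp [constantCoeff_X]
  · refine Fin.cases ?_ (fun i => ?_) j
    · simp [hΦ, constantCoeff_X]
    · simp [hΦ, constantCoeff_X]
  · have hK : HasSubst (fun v : Fin (n + 1 + 1) => if v = 0 then (X (0 : Fin (n + 1 + 1)) : MvPowerSeries (Fin (n + 1 + 1)) k)
        else 0) := hasSubst_of_constantCoeff_zero fun v => by
      by_cases hv : v = 0 <;> simp [hv, constantCoeff_X]
    refine Fin.cases ?_ (fun i => ?_) j
    · simp only [hΦ, Fin.cases_zero]
      rw [subst_mul hK, subst_X hK]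
      simp
    · simp only [hΦ, Fin.cases_succ]
      rw [subst_mul hK, subst_pow hK, subst_X hK]
      simp
  · have hM : (Matrix.of fun i j : Fin (n + 1) => coeff (Finsupp.single j.succ 1) (Φ i)) =
        (1 : Matrix (Fin (n + 1)) (Fin (n + 1)) k) := by
      ext i j
      rw [Matrix.of_apply, Matrix.one_apply]
      revert i
      refine Fin.cases ?_ (fun i => ?_)
      · simp only [hΦ, Fin.cases_zero]
        rw [hlam, coeff_single_succ_embσ_mul_X, hlam1c]
        simp only [eq_comm]
      · simp only [hΦ, Fin.cases_succ]
        rw [hlamInv, ← embσ_pow, coeff_single_succ_embσ_mul_X, map_pow, PowerSeries.constantCoeff_inv, hlam1c,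
          inv_one, one_pow]
        simp only [eq_comm]
    rw [hM, Matrix.det_one]
    exact isUnit_one
  · have hTeq : (fun i : Fin (n + 1) => X i.succ +
        subst (fun _ : Fin 1 => (X (0 : Fin (n + 1 + 1)) : MvPowerSeries (Fin (n + 1 + 1)) k) ^ (p ^ e))
          (axisCurve (k := k) i₀.succ i)) = T := by
      have ha : HasSubst (fun _ : Fin 1 => (X (0 : Fin (n + 1 + 1)) : MvPowerSeries (Fin (n + 1 + 1)) k) ^ (p ^ e)) :=
        hasSubst_of_constantCoeff_zero fun _ => by simp [constantCoeff_X, zero_pow hpe0]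
      funext v
      refine Fin.cases ?_ (fun i => ?_) v
      · have h0 : (0 : Fin (n + 1)) ≠ i₀.succ := (Fin.succ_ne_zero i₀).symm
        simp only [hT, Fin.cases_zero, axisCurve, if_neg h0]
        rw [← coe_substAlgHom ha, map_zero, add_zero]
      · simp only [hT, Fin.cases_succ, axisCurve]
        by_cases hi : i = i₀
        · subst hi
          simp only [if_true, subst_X ha]
        · rw [if_neg (fun h' => hi (Fin.succ_injective _ h')), if_neg hi, ← coe_substAlgHom ha, map_zero]
    rw [hTeq]
    exact Emain

/-- B2 (SKETCH'S SIGNATURE, VERBATIM) — WILD SUCCESSORS ARE TWISTED CYLINDERS: at an AXIS exceptional point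
`c = c₀ e_{i₀}` the successor is twisted-trivial along the `y_{i₀}`-axis (the orbit curve of `c`), with
exponent `v_p(w_{i₀})`.  Corollary of the origin-fixing form `successor_twistedTrivialFix_axis`; the
hypothesis `hg` is part of the sketch's signature and unused. [OURS · L1 W4.3, Sketch-L1-idea-1 v3 §1] -/
theorem successor_twistedTrivial_axis (p : ℕ) [Fact p.Prime] [CharP k p] [IsAlgClosed k] {n : ℕ}
    (F : MvPowerSeries (Fin n) k) (w : Fin n → ℕ) (c : Fin n → k) (i₀ : Fin n)
    (hc : ∀ i, i ≠ i₀ → c i = 0) (hc₀ : c i₀ ≠ 0) (hw : 0 < w i₀) (a : ℕ) (g : MvPowerSeries (Fin (n + 1)) k)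
    (h : subst (CobordantGame.cruxChart k w c) F = X (0 : Fin (n + 1)) ^ a * g)
    (_hg : ¬ (X (0 : Fin (n + 1)) ∣ g)) :
    TwistedTrivialAlong p g (axisCurve i₀.succ) :=
  twistedTrivialAlong_of_fix p g _ (successor_twistedTrivialFix_axis p F w c i₀ hc hc₀ hw a g h)

end GradedGame

end Summit.ResolutionOfSingularities.ResolutionOfSingularities.Theorems
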